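import Summits.Ventures.Crystal3D.Bulk.RotSysCorners
import HarnessLib

/-!
# Inserting one edge into a sub-rotation-system: connectivity, the MERGE criterion from the
# Euler characteristic, and the corners (generic brick for LEMMA L by edge-insertion induction,
# `HOME/lean/lemmaL/DESIGN.md` R1.7′)

HONEST FRAMING. Part of the venture `Summits/Ventures/Crystal3D` (cell `pub-crystal3d`, phase 2;
seat typer-bulk-2), PURELY COMBINATORIAL and generic (folklore): no geometry, no configuration,
nothing about GAP(1.26). The edge-insertion induction for LEMMA L (`Bulk/RotSysConvexFaces.lean`)
passes from an `α`-closed dart set `S ∖ {d, α d}` to `S` (INSERTING the edge `e = {d, α d}`) and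
reads the insertion backwards as a deletion, for which the tree has the bookkeeping
(`Bulk/RotSysDelete*.lean`, `Bulk/RotSysEuler.lean`, `Bulk/RotSysCorners.lean`). This file
collects what the induction needs, for a loopless rotation system `(σ, α)`:

* `IsRotSys.numK_le_numK_sdiff_of_sameCycle` — if a surviving dart sits at the vertex of `d`,
  inserting `e` does not increase the number of components (`numK S ≤ numK (S ∖ e)`);
* **the MERGE criterion** `IsRotSys.not_sameCycle_phi_of_chi2_eq` — if neither end of `e` is
  alone at its vertex in `S` and `chi2 (S ∖ e) = chi2 S`, then `d` and `α d` lie on DIFFERENT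
  faces of `S` (otherwise the deletion splits a face: one face more, same vertices, two darts
  fewer — `chi2` would go up by `4`);
* **corners under insertion** (non-negative weights `w`): `cornerAt_nonneg`;
  `IsRotSys.cornerAt_le_cornerAt_sdiff` — at a surviving dart the corner of `S` is at most the
  corner of `S ∖ e`; `IsRotSys.exists_cornerAt_le_of_not_alone` — the corner of `S` at `d` is at
  most the corner of `S ∖ e` at the `S`-predecessor of `d`; hence
  **`IsRotSys.cornerAt_lt_of_sdiff`**: if neither end of `e` is alone and all corners of
  `S ∖ e` are `< b`, then all corners of `S` are `< b`.
-/

namespace Summit.Ventures.Crystal3D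

namespace RotSys

open Equiv Equiv.Perm Finset Function

variable {D : Type*} [DecidableEq D] [Fintype D]

/-! ## Connectivity under insertion -/

section Connectivity

open scoped Classical

variable {σ α : Perm D} {S : Finset D} {d : D}

omit [Fintype D] in
/-- **Inserting an edge at an occupied vertex does not disconnect**: if some dart of
`S ∖ {d, α d}` lies at the vertex of `d`, then `numK S ≤ numK (S ∖ {d, α d})`. -/
theorem IsRotSys.numK_le_numK_sdiff_of_sameCycle (h : IsRotSys σ α) (hS : IsClosed α S)
    (hd : d ∈ S) {z : D} (hz : z ∈ S \ {d, α d}) (hc : σ.SameCycle d z) :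
    numK σ α S ≤ numK σ α (S \ {d, α d}) := by
  have key := h.numK_le_numK_sdiff_add hS hd
  rwa [if_pos (exists_conn_of_not_alone hS hd (Or.inl rfl) hz hc), add_zero] at key

end Connectivity

/-! ## The MERGE criterion from the Euler characteristic -/

section Criterion

open scoped Classical

variable {σ α : Perm D} {S : Finset D} {d : D}

/-- **MERGE from Euler.** If neither `d` nor `α d` is alone at its vertex in `S` and deleting
the edge `{d, α d}` does not change `chi2`, then `d` and `α d` lie on DIFFERENT faces of `S`
(otherwise the deletion would split a face: `F + 1` faces, same vertices, two darts fewer,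
`chi2` up by `4`). -/
theorem IsRotSys.not_sameCycle_phi_of_chi2_eq (h : IsRotSys σ α) (hS : IsClosed α S)
    (hd : d ∈ S) (hna : induce σ S d ≠ d) (hnb : induce σ S (α d) ≠ α d)
    (hchi : chi2 σ α (S \ {d, α d}) = chi2 σ α S) :
    ¬ (phi σ α S).SameCycle d (α d) := by
  intro hsame
  have ha : phi σ α S (α d) ≠ d := by rw [phi_apply, h.α_inv]; exact hna
  have hb : phi σ α S d ≠ α d := by rw [phi_apply]; exact hnb
  have hV := h.numV_sdiff hS hd
  rw [if_neg hb, if_neg ha, add_zero, add_zero] at hV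
  have hE := h.card_sdiff hS hd
  have hF := h.numF_sdiff_split hS hd hsame
  rw [if_neg ha, if_neg hb, add_zero, add_zero] at hF
  unfold chi2 at hchi
  rw [hV, hF] at hchi
  push_cast at hchi
  omega

end Criterion

/-! ## Corners under insertion of an edge -/

section Corners

variable {σ α : Perm D} {S : Finset D} {d : D}

omit [Fintype D] in
/-- A corner with non-negative weights is non-negative. -/
theorem cornerAt_nonneg (σ : Perm D) {w : D → ℝ} (hw : ∀ x, 0 ≤ w x) (S : Finset D) (z : D) :
    0 ≤ cornerAt σ w S z :=
  Finset.sum_nonneg fun _ _ => hw _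

/-- **Inserting an edge shrinks corners**: for a surviving dart `z`, the corner of `S` at `z` is
at most the corner of `S ∖ {d, α d}` at `z` (non-negative weights). -/
theorem IsRotSys.cornerAt_le_cornerAt_sdiff (h : IsRotSys σ α) (hS : IsClosed α S) (hd : d ∈ S)
    {w : D → ℝ} (hw : ∀ x, 0 ≤ w x) {z : D} (hz : z ∈ S \ {d, α d}) :
    cornerAt σ w S z ≤ cornerAt σ w (S \ {d, α d}) z := by
  rw [h.cornerAt_sdiff hS hd w hz]
  have h1 : 0 ≤ (if induce σ S z = d then cornerAt σ w S d else 0) := by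
    split_ifs
    · exact cornerAt_nonneg σ hw S d
    · exact le_rfl
  have h2 : 0 ≤ (if induce σ S z = α d then cornerAt σ w S (α d) else 0) := by
    split_ifs
    · exact cornerAt_nonneg σ hw S (α d)
    · exact le_rfl
  linarith

/-- **The corner at the inserted dart** `d` is at most the corner of `S ∖ {d, α d}` at the
`S`-predecessor of `d` around its vertex — which survives when `d` is not alone at its vertex. -/
theorem IsRotSys.exists_cornerAt_le_of_not_alone (h : IsRotSys σ α) (hS : IsClosed α S)
    (hd : d ∈ S) {w : D → ℝ} (hw : ∀ x, 0 ≤ w x) (hna : induce σ S d ≠ d) :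
    ∃ z ∈ S \ {d, α d}, cornerAt σ w S d ≤ cornerAt σ w (S \ {d, α d}) z := by
  -- the `S`-predecessor `z` of `d`
  set z := (induce σ S)⁻¹ d with hz_def
  have hzd : induce σ S z = d := by rw [hz_def]; exact (induce σ S).apply_symm_apply d
  have hzS : z ∈ S := by
    have := (induce_apply_mem_iff σ S z).1 (by rw [hzd]; exact hd)
    exact this
  have hz : z ∈ S \ {d, α d} := by
    refine mem_sdiff_pair_iff.2 ⟨hzS, ?_, ?_⟩
    · intro e; rw [e] at hzd; exact hna hzd
    · intro e
      rw [e] at hzd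
      have := h.induce_ne_alpha S (α d)
      rw [h.α_inv] at this
      exact this hzd
  refine ⟨z, hz, ?_⟩
  rw [h.cornerAt_sdiff hS hd w hz, if_pos hzd]
  have h2 : 0 ≤ (if induce σ S z = α d then cornerAt σ w S (α d) else 0) := by
    split_ifs
    · exact cornerAt_nonneg σ hw S (α d)
    · exact le_rfl
  have h0 := cornerAt_nonneg σ hw S z
  linarith

/-- **Inserting an edge keeps all corners below a bound.** If neither end of `{d, α d}` is alone
at its vertex in `S` and every corner of `S ∖ {d, α d}` is `< b`, then every corner of `S` is
`< b` (non-negative weights). -/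
theorem IsRotSys.cornerAt_lt_of_sdiff (h : IsRotSys σ α) (hS : IsClosed α S) (hd : d ∈ S)
    {w : D → ℝ} (hw : ∀ x, 0 ≤ w x) (hna : induce σ S d ≠ d) (hnb : induce σ S (α d) ≠ α d)
    {b : ℝ} (hlt : ∀ z ∈ S \ {d, α d}, cornerAt σ w (S \ {d, α d}) z < b) :
    ∀ z ∈ S, cornerAt σ w S z < b := by
  intro z hzS
  by_cases hz : z ∈ S \ {d, α d}
  · exact (h.cornerAt_le_cornerAt_sdiff hS hd hw hz).trans_lt (hlt z hz)
  · rw [mem_sdiff_pair_iff, not_and, not_and_or, not_not, not_not] at hz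
    rcases hz hzS with rfl | rfl
    · obtain ⟨y, hy, hle⟩ := h.exists_cornerAt_le_of_not_alone hS hd hw hna
      exact hle.trans_lt (hlt y hy)
    · have hαd : α d ∈ S := hS d hd
      obtain ⟨y, hy, hle⟩ := h.exists_cornerAt_le_of_not_alone hS hαd hw hnb
      rw [h.α_inv, pair_comm] at hy hle
      exact hle.trans_lt (hlt y hy)

end Corners

end RotSys

end Summit.Ventures.Crystal3D
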